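import Literature.NumberTheory.EllipticCurves.ZpExtensionEisensteinAdicTower
import Literature.NumberTheory.EllipticCurves.IwasawaEisensteinTwistedReadoutReduceProofs
import Literature.NumberTheory.EllipticCurves.IwasawaEisensteinTwistedRepH1TransportProofs
import Literature.NumberTheory.GaloisCohomology.Howard2004.DVRKolyvaginBound
import HarnessLib

/-!
# The level readouts along the transition maps `inc` of Howard's tower `T_𝔮/p^{k+1} T_𝔮`

Topic `NumberTheory/EllipticCurves` (sequel to `ZpExtensionEisensteinAdicTower` (`eisensteinAdicTowerSucc`, D1's tower with
`e_k = m(k+1)`), `Howard2004/DVRKolyvaginBound` (`AdicTower.inc`, `incH1`: the transition maps of `A = colim_k T/𝔪^{e_k}`,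
multiplication by `π^{e_{k+1}-e_k}` on lifts), `IwasawaEisensteinTwistedReadoutReduceProofs` (readout vs. reduction) and
`IwasawaEisensteinTwistedRepH1Transport{,Proofs}` (the level readout `eisensteinTwistLevelReadout`); cell `pub/bsd-print-x9`,
blueprint HOME/p2/S1-DISCRETE-CONTROL §1(d)).  Theorems only; no definition, no named fact, no `sorry`.

For the shifted Eisenstein tower (`π = T mod q_m`, `e_{k+1} - e_k = m`, so `π^m = [T^m] = -p` on the levels):
* `eisensteinAdicTowerSucc_inc_red`: `inc_k (red_k y) = -(p · y)`;
* `tailReadout_eisensteinAdicTowerSucc_inc`: `λ_{k+2}(inc_k x) = -ι(λ_{k+1}(x))` for any additive `ι : M_{k+1} → M_{k+2}` with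
  `ι ∘ t_{k+1} = p·` (for `E`: `E[p^{k+1}] ↪ E[p^{k+2}]`);
* **`eisensteinTwistLevelReadout_incH1`**: on cohomology, `readout_{k+2} ∘ H¹(inc_k) = -ι_* ∘ readout_{k+1}` — the level
  readouts `H¹(K, T_𝔮/p^{k+1}T_𝔮) → H¹(K_∞, M_{k+1})` form, up to the sign `(-1)^k`, a map of direct systems towards
  `H¹(K_∞, colim_k M_k)`; this is the compatibility needed to pass to Howard's `H¹(K, A_𝔮) = colim_k` (`AdicTower.H1A`).

References: [Howard2004HeegnerKolyvagin] §1.6 (arXiv p. 11 L18–20, p. 12 L40–48), §2.2, proof of Thm. 2.2.10;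
[GreenbergLNM1716] §4 p. 124; [Washington1997] §13.2.  BSD is not proved by any of this.
-/

noncomputable section

open Literature.NumberTheory.EllipticCurves Literature.NumberTheory.GaloisRepresentations Field
open Literature.NumberTheory.GaloisCohomology.Howard2004
open CategoryTheory ContinuousCohomology IwasawaAlgebra IwasawaAlgebra.EisensteinCoeff IwasawaAlgebra.EisensteinCoeff.TwistedBy
open scoped ContRepresentation

namespace Literature.NumberTheory.EllipticCurves

namespace ZpExtension

variable {K : Type} [Field K] {p : ℕ} [hp : Fact p.Prime] (κ : ZpExtension K p)
  {M : ℕ → Type} [∀ k, AddCommGroup (M k)] [∀ k, TopologicalSpace (M k)] [∀ k, DiscreteTopology (M k)]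
  (ρ : ∀ k, DiscreteGaloisModule K (M k))
  (t : ∀ k, (ρ (k + 1)).toContRepresentation →ⁱL (ρ k).toContRepresentation)
  {m : ℕ} (hm : 1 ≤ m) (ht : ∀ k, Function.Surjective (t k))

/-- **`inc_k ∘ red_k = -p`** on the shifted Eisenstein tower: the transition map `inc_k` of `A = colim_k T/𝔪^{e_k}T` is
multiplication by `π^{e_{k+1}-e_k} = π^m = [T^m] = -p` on lifts along `red_k`.
[cite: Howard2004HeegnerKolyvagin, §1.6 (arXiv p. 12, L40–48) and proof of Thm. 2.2.10 (𝔮 = T^m + p)] -/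
theorem eisensteinAdicTowerSucc_inc_red (k : ℕ) :
    letI := IwasawaAlgebra.isLocalRing_quotient_X_pow_add_C p hm
    ∀ (π : IwasawaAlgebra p ⧸ Ideal.span {(PowerSeries.X ^ m + PowerSeries.C (p : ℤ_[p]) : IwasawaAlgebra p)})
      (e : ℕ → ℕ)
      (hkill : ∀ k, ∀ r ∈ IsLocalRing.maximalIdeal _ ^ e k, ∀ x : EisensteinLevel p m M (k + 1), r • x = 0)
      (hker : ∀ k, LinearMap.ker ((κ.eisensteinAdicTowerSucc ρ t hm ht).red k) =
        (IsLocalRing.maximalIdeal _ ^ e k) • (⊤ : Submodule _ (EisensteinLevel p m M (k + 1 + 1))))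
      (hπ : π ∈ IsLocalRing.maximalIdeal _) (he : ∀ k, e k ≤ e (k + 1)),
      π = Ideal.Quotient.mk _ PowerSeries.X → e (k + 1) - e k = m →
      ∀ y : EisensteinLevel p m M (k + 1 + 1),
        AdicTower.inc (κ.eisensteinAdicTowerSucc ρ t hm ht) π e hkill hker hπ he k
          ((κ.eisensteinAdicTowerSucc ρ t hm ht).red k y) = -(p • y) := by
  intro π e hkill hker hπ he hπX hek y
  letI := IwasawaAlgebra.isLocalRing_quotient_X_pow_add_C p hm
  rw [AdicTower.inc_red, hek, hπX, ← map_pow, EisensteinLevel.quotient_mk_smul_def,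
    IwasawaAlgebra.EisensteinCoeff.mk_X_pow_eq_neg_natCast p (k + 1 + 1), neg_smul, Nat.cast_smul_eq_nsmul]

omit [∀ k, TopologicalSpace (M k)] [∀ k, DiscreteTopology (M k)] in
/-- `λ_{k+2}(-(p·y)) = -ι(λ_{k+1}((reduce ⊗ t) y))` when `ι ∘ t = p·` (all in the `Twisted` currency). [cite: Washington1997, §13.2] -/
theorem tailReadout_neg_nsmul_eq_neg_map_tailReadout_reduce (k : ℕ)
    (hM₁ : ∀ a : M (k + 1), (p ^ (k + 1)) • a = 0) (hM₂ : ∀ a : M (k + 1 + 1), (p ^ (k + 1 + 1)) • a = 0)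
    (f : M (k + 1 + 1) →ₗ[ℤ] M (k + 1)) (ι : M (k + 1) →+ M (k + 1 + 1)) (hιf : ∀ P : M (k + 1 + 1), ι (f P) = p • P)
    (y : Twisted p m (k + 1 + 1) (M (k + 1 + 1))) :
    Twisted.tailReadout p hm (k + 1 + 1) hM₂ (-(p • y)) =
      -ι (Twisted.tailReadout p hm (k + 1) hM₁ (eisensteinTwistReduceLinear (p := p) (Nat.le_succ (k + 1)) f y)) := by
  rw [map_neg, map_nsmul, Twisted.tailReadout_eisensteinTwistReduceLinear p hm (Nat.le_succ (k + 1)) hM₁ hM₂, hιf]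

/-- **`λ_{k+2}(inc_k x) = -ι(λ_{k+1} x)`**: the tail readouts of consecutive levels along the transition map, for any additive
`ι : M_{k+1} → M_{k+2}` with `ι(t_{k+1} P) = p · P` (for `E`: the inclusion `E[p^{k+1}] ↪ E[p^{k+2}]`, `t = (P ↦ p·P)`).
[cite: Howard2004HeegnerKolyvagin, §1.6 (arXiv p. 12) and §2.2] [cite: Washington1997, §13.2] -/
theorem tailReadout_eisensteinAdicTowerSucc_inc (k : ℕ)
    (hM₁ : ∀ a : M (k + 1), (p ^ (k + 1)) • a = 0) (hM₂ : ∀ a : M (k + 1 + 1), (p ^ (k + 1 + 1)) • a = 0)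
    (ι : M (k + 1) →+ M (k + 1 + 1)) (hιt : ∀ P : M (k + 1 + 1), ι (t (k + 1) P) = p • P) :
    letI := IwasawaAlgebra.isLocalRing_quotient_X_pow_add_C p hm
    ∀ (π : IwasawaAlgebra p ⧸ Ideal.span {(PowerSeries.X ^ m + PowerSeries.C (p : ℤ_[p]) : IwasawaAlgebra p)})
      (e : ℕ → ℕ)
      (hkill : ∀ k, ∀ r ∈ IsLocalRing.maximalIdeal _ ^ e k, ∀ x : EisensteinLevel p m M (k + 1), r • x = 0)
      (hker : ∀ k, LinearMap.ker ((κ.eisensteinAdicTowerSucc ρ t hm ht).red k) =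
        (IsLocalRing.maximalIdeal _ ^ e k) • (⊤ : Submodule _ (EisensteinLevel p m M (k + 1 + 1))))
      (hπ : π ∈ IsLocalRing.maximalIdeal _) (he : ∀ k, e k ≤ e (k + 1)),
      π = Ideal.Quotient.mk _ PowerSeries.X → e (k + 1) - e k = m →
      ∀ x : EisensteinLevel p m M (k + 1),
        Twisted.tailReadout p hm (k + 1 + 1) hM₂
            (AdicTower.inc (κ.eisensteinAdicTowerSucc ρ t hm ht) π e hkill hker hπ he k x :
              Twisted p m (k + 1 + 1) (M (k + 1 + 1))) =
          -ι (Twisted.tailReadout p hm (k + 1) hM₁ (x : Twisted p m (k + 1) (M (k + 1)))) := by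
  intro π e hkill hker hπ he hπX hek x
  letI := IwasawaAlgebra.isLocalRing_quotient_X_pow_add_C p hm
  obtain ⟨y, rfl⟩ := (κ.eisensteinAdicTowerSucc ρ t hm ht).red_surjective k x
  rw [κ.eisensteinAdicTowerSucc_inc_red ρ t hm ht k π e hkill hker hπ he hπX hek y]
  exact tailReadout_neg_nsmul_eq_neg_map_tailReadout_reduce hm k hM₁ hM₂
    (t (k + 1)).toContinuousLinearMap.toLinearMap ι hιt (y : Twisted p m (k + 1 + 1) (M (k + 1 + 1)))

variable [∀ k, DistribMulAction (absoluteGaloisGroup K) (M k)] (κ₀ : ZpExtension K p) (k : ℕ)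
  (χ₁ : absoluteGaloisGroup K →* EisensteinCoeff p m (k + 1))
  (hact₁ : ∀ (σ : absoluteGaloisGroup K) (x : Twisted p m (k + 1) (M (k + 1))),
    κ.eisensteinTwist (ρ (k + 1)) hm (k + 1) σ x = (ofTwisted χ₁ (M (k + 1))).symm (σ • ofTwisted χ₁ (M (k + 1)) x))
  (χ₂ : absoluteGaloisGroup K →* EisensteinCoeff p m (k + 1 + 1))
  (hact₂ : ∀ (σ : absoluteGaloisGroup K) (x : Twisted p m (k + 1 + 1) (M (k + 1 + 1))),
    κ.eisensteinTwist (ρ (k + 1 + 1)) hm (k + 1 + 1) σ x =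
      (ofTwisted χ₂ (M (k + 1 + 1))).symm (σ • ofTwisted χ₂ (M (k + 1 + 1)) x))
  (hM₁ : ∀ a : M (k + 1), (p ^ (k + 1)) • a = 0) (hM₂ : ∀ a : M (k + 1 + 1), (p ^ (k + 1 + 1)) • a = 0)
  (hχker₁ : ∀ σ ∈ κ₀.kerSubgroup, χ₁ σ = 1) (hχker₂ : ∀ σ ∈ κ₀.kerSubgroup, χ₂ σ = 1)
  (ι : M (k + 1) →+ M (k + 1 + 1))
  (hι' : ∀ (x : κ₀.kerSubgroup) (a : M (k + 1)), ι (ContinuousMonoidHom.id κ₀.kerSubgroup x • a) = x • ι a)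
  (hιt : ∀ P : M (k + 1 + 1), ι (t (k + 1) P) = p • P)

include hιt in
/-- **The level readouts along `H¹(inc)`**: `readout_{k+2}(H¹(inc_k) c) = -ι_*(readout_{k+1} c)` in `H¹(K_∞, M_{k+2})` for every
class `c ∈ H¹(K, T_𝔮/p^{k+1}T_𝔮)` — so `((-1)^k ι_{k,∞,*} ∘ readout_{k+1})_k` is a map of direct systems
`(H¹(K, T_𝔮/p^{k+1}), H¹(inc)) → H¹(K_∞, colim M_k)`, the level-wise description of Howard's
`H¹(K, A_𝔮) → H¹(K_∞, E[p^∞])[𝔮]`. [cite: Howard2004HeegnerKolyvagin, §1.6 (arXiv p. 12, L40–48) and §2.2, proof of Thm. 2.2.10]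
[cite: GreenbergLNM1716, §4 p. 124] -/
theorem eisensteinTwistLevelReadout_incH1 :
    letI := IwasawaAlgebra.isLocalRing_quotient_X_pow_add_C p hm
    ∀ (π : IwasawaAlgebra p ⧸ Ideal.span {(PowerSeries.X ^ m + PowerSeries.C (p : ℤ_[p]) : IwasawaAlgebra p)})
      (e : ℕ → ℕ)
      (hkill : ∀ k, ∀ r ∈ IsLocalRing.maximalIdeal _ ^ e k, ∀ x : EisensteinLevel p m M (k + 1), r • x = 0)
      (hker : ∀ k, LinearMap.ker ((κ.eisensteinAdicTowerSucc ρ t hm ht).red k) =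
        (IsLocalRing.maximalIdeal _ ^ e k) • (⊤ : Submodule _ (EisensteinLevel p m M (k + 1 + 1))))
      (hπ : π ∈ IsLocalRing.maximalIdeal _) (he : ∀ k, e k ≤ e (k + 1)),
      π = Ideal.Quotient.mk _ PowerSeries.X → e (k + 1) - e k = m →
      ∀ c : galoisCohomology ((κ.eisensteinAdicTowerSucc ρ t hm ht).ρ k) 1,
        κ.eisensteinTwistLevelReadout hm (k + 1 + 1) χ₂ (ρ (k + 1 + 1)) hact₂ κ₀ hM₂ hχker₂
            (AdicTower.incH1 (κ.eisensteinAdicTowerSucc ρ t hm ht) π e hkill hker hπ he k c) =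
          -(resH1Hom (ContinuousMonoidHom.id κ₀.kerSubgroup) ι hι'
            (κ.eisensteinTwistLevelReadout hm (k + 1) χ₁ (ρ (k + 1)) hact₁ κ₀ hM₁ hχker₁ c)) := by
  intro π e hkill hker hπ he hπX hek c
  letI := IwasawaAlgebra.isLocalRing_quotient_X_pow_add_C p hm
  have hlast : m - 1 < m := Nat.sub_lt (lt_of_lt_of_le zero_lt_one hm) zero_lt_one
  obtain ⟨ξ, rfl⟩ := oneCocycleClass_surjective _ c
  -- `H¹(inc) [ξ] = [inc ∘ ξ]`
  obtain ⟨ξ', hξ', hval⟩ : ∃ ξ' : contOneCocycles ((κ.eisensteinAdicTowerSucc ρ t hm ht).ρ (k + 1)).toTopRep,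
      AdicTower.incH1 (κ.eisensteinAdicTowerSucc ρ t hm ht) π e hkill hker hπ he k (oneCocycleClass _ ξ) =
        oneCocycleClass _ ξ' ∧
      ∀ σ, ξ'.1 σ = AdicTower.inc (κ.eisensteinAdicTowerSucc ρ t hm ht) π e hkill hker hπ he k (ξ.1 σ) :=
    ⟨_, by change ContinuousCohomology.map _ _ 1 _ = _; erw [map_oneCocycleClass], fun _ ↦ rfl⟩
  rw [hξ']
  obtain ⟨φ, hφ⟩ := κ.exists_coordCocycles hm (k + 1) χ₁ (ρ (k + 1)) hact₁ κ₀ hM₁ hχker₁ ξ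
  obtain ⟨φ', hφ'⟩ := κ.exists_coordCocycles hm (k + 1 + 1) χ₂ (ρ (k + 1 + 1)) hact₂ κ₀ hM₂ hχker₂ ξ'
  rw [show κ.eisensteinTwistLevelReadout hm (k + 1 + 1) χ₂ (ρ (k + 1 + 1)) hact₂ κ₀ hM₂ hχker₂
      (oneCocycleClass ((κ.eisensteinAdicTowerSucc ρ t hm ht).ρ (k + 1)).toTopRep ξ') = oneCocycleClass _ (φ' ⟨m - 1, hlast⟩)
      from κ.eisensteinTwistLevelReadout_oneCocycleClass hm (k + 1 + 1) χ₂ (ρ (k + 1 + 1)) hact₂ κ₀ hM₂ hχker₂ ξ' φ' hφ',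
    show κ.eisensteinTwistLevelReadout hm (k + 1) χ₁ (ρ (k + 1)) hact₁ κ₀ hM₁ hχker₁
      (oneCocycleClass ((κ.eisensteinAdicTowerSucc ρ t hm ht).ρ k).toTopRep ξ) = oneCocycleClass _ (φ ⟨m - 1, hlast⟩)
      from κ.eisensteinTwistLevelReadout_oneCocycleClass hm (k + 1) χ₁ (ρ (k + 1)) hact₁ κ₀ hM₁ hχker₁ ξ φ hφ]
  have hres : resH1Hom (ContinuousMonoidHom.id κ₀.kerSubgroup) ι hι' (oneCocycleClass _ (φ ⟨m - 1, hlast⟩)) =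
      oneCocycleClass _ (contOneCocycles.pullback (ContinuousMonoidHom.id κ₀.kerSubgroup)
        (resHomOfEquivariant (ContinuousMonoidHom.id κ₀.kerSubgroup) ι hι') (φ ⟨m - 1, hlast⟩)) :=
    map_oneCocycleClass _ _ _ _
  rw [hres, eq_neg_iff_add_eq_zero, ← oneCocycleClass_add]
  have hsum : φ' ⟨m - 1, hlast⟩ + contOneCocycles.pullback (ContinuousMonoidHom.id κ₀.kerSubgroup)
      (resHomOfEquivariant (ContinuousMonoidHom.id κ₀.kerSubgroup) ι hι') (φ ⟨m - 1, hlast⟩) = 0 := by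
    apply Subtype.ext
    ext h
    have e1 : (φ' ⟨m - 1, hlast⟩).1 h =
        -ι (Twisted.tailReadout p hm (k + 1) hM₁ (ξ.1 (h : absoluteGaloisGroup K))) := by
      refine (hφ' _ h).trans ?_
      refine (tailReadout_eq_tailReadout_dualFamily_last_smul hm (k + 1 + 1) hM₂ _).symm.trans ?_
      refine (congrArg (Twisted.tailReadout p hm (k + 1 + 1) hM₂) (hval _)).trans ?_
      exact κ.tailReadout_eisensteinAdicTowerSucc_inc ρ t hm ht k hM₁ hM₂ ι hιt π e hkill hker hπ he hπX hek _
    have e2 : (φ ⟨m - 1, hlast⟩).1 h = Twisted.tailReadout p hm (k + 1) hM₁ (ξ.1 (h : absoluteGaloisGroup K)) :=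
      (hφ _ h).trans (tailReadout_eq_tailReadout_dualFamily_last_smul hm (k + 1) hM₁ _).symm
    change (φ' ⟨m - 1, hlast⟩).1 h + ι ((φ ⟨m - 1, hlast⟩).1 h) = 0
    rw [e1, e2, neg_add_cancel]
  rw [hsum, oneCocycleClass_zero]

end ZpExtension

end Literature.NumberTheory.EllipticCurves
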